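import Mathlib
import HarnessLib
import Summits.ValiantsHypothesis.ValiantsHypothesis.Theses.MonotoneRestoration
import Literature.Computability.AlgebraicComplexity.ArithCircuit
import Literature.Computability.AlgebraicComplexity.ArithCircuitProofs
import Literature.Computability.AlgebraicComplexity.MonotoneStructure
import Literature.Computability.AlgebraicComplexity.PermanentIrreducible
import Literature.ModelTheory.FiniteModelTheory.CkEquiv
import Summits.ValiantsHypothesis.ValiantsHypothesis.Theorems.MonotoneRestorationMonotoneRestorationQPCosetCount
import Summits.ValiantsHypothesis.ValiantsHypothesis.Theorems.MonotoneRestorationMonotoneRestorationQPSymmetricLB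
import Summits.ValiantsHypothesis.ValiantsHypothesis.Theorems.MonotoneRestorationMonotoneRestorationQPSupportSymmetrisation
import Summits.ValiantsHypothesis.ValiantsHypothesis.Theorems.MonotoneRestorationMonotoneRestorationQPSparseRegime
import Summits.ValiantsHypothesis.ValiantsHypothesis.Theorems.MonotoneRestorationMonotoneRestorationQPBeta
import Literature.Computability.AlgebraicComplexity.SymmetricArithCircuit
import Literature.Computability.AlgebraicComplexity.DawarWilsenach2025Proofs
import Literature.GroupTheory.PermutationGroups.SmallIndexSubgroups
import Summits.ValiantsHypothesis.ValiantsHypothesis.Theorems.MonotoneRestorationQP.Negative.LoadBearing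
import Summits.ValiantsHypothesis.ValiantsHypothesis.Theorems.MonotoneRestorationMonotoneRestorationQPPermSupportCount
import Literature.Computability.AlgebraicComplexity.RazElusiveGeneralRouteProofs

/-! TTRL-lite variant V19268 of stmt-ValiantsHypothesis-15886

Variant V19268 (`lemma_proposal`, `[map_coeff]`) of the stub `stub_esymmRowSums_complexity` of line
c2 of the crux `MonotoneRestorationQP`: changing coefficients along a ring homomorphism never
increases the fan-in-two circuit complexity, `L_{K'}(map φ f) ≤ L_K(f)` — map every constant and
every sum coefficient of a size-optimal circuit along `φ` (`ArithCircuit.map`; size and fan-in are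
unchanged, and the mapped circuit computes `MvPolynomial.map φ f`).  This is exactly the tree lemma
`ArithCircuit.complexity_map_le` (`Literature/Computability/AlgebraicComplexity/RazElusiveGeneralRouteProofs.lean`,
universe-polymorphic in `K`, `K'`, `σ`), instantiated at `Type`.
-/

-- `ValiantsHypothesis.ValiantsHypothesis`: the D-0017 layout repeats the problem name in the path.
set_option linter.dupNamespace false

namespace Summit.ValiantsHypothesis.ValiantsHypothesis.Theorems

open Summit.ValiantsHypothesis.ValiantsHypothesis.Theses.MonotoneRestoration
open Literature.Computability.AlgebraicComplexity

/-- **TTRL-lite variant V19268** (`[map_coeff]`) of `stub_esymmRowSums_complexity`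
(stmt-ValiantsHypothesis-15886): extension / change of scalars is free for circuit complexity —
for every ring homomorphism `φ : K →+* K'` and every `f : MvPolynomial σ K`,
`complexity (MvPolynomial.map φ f) ≤ complexity f` (map the constants and coefficients of a
size-optimal fan-in-two circuit for `f` along `φ`, gate by gate).  Instance of the tree lemma
`ArithCircuit.complexity_map_le`. [cite: Burgisser2000, §4.1] [cite: Raz2010, Prop. 5.6, proof] -/
theorem stub_esymmRowSums_complexity_var19268 :
    ∀ (K K' : Type) [CommSemiring K] [CommSemiring K'] (φ : K →+* K') (σ : Type)
      (f : MvPolynomial σ K), complexity (MvPolynomial.map φ f) ≤ complexity f :=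
  fun _K _K' _ _ φ _σ f => ArithCircuit.complexity_map_le φ f

end Summit.ValiantsHypothesis.ValiantsHypothesis.Theorems
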